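import Summits.ABC.ABC.Theses.CubicResolventAllowance
import Literature.NumberTheory.EllipticCurves.Szpiro
import Literature.NumberTheory.CubicFields.CubicFieldSignatureFromDiscriminant
import HarnessLib

/-!
# Route CubicResolventAllowance — crux `IndexSzpiro` (stmt-ABC-22740): the sign halves of the skeleton

Helper file for the registered skeleton of `IndexSzpiro` (line `birth`, stubs `stub_realCubic`
(`0 < d_K`) and `stub_complexCubic` (`d_K < 0`)). It proves, sorry-free and with no named fact:

* `indexSzpiroReal_of_indexSzpiro`, `indexSzpiroComplex_of_indexSzpiro` — the crux gives each
  sign half (drop the sign hypothesis);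
* `indexSzpiro_of_signHalves`, `indexSzpiro_iff_signHalves` — the two halves compose back to the
  crux (`d_K ≠ 0`, `NumberField.discr_ne_zero`; constant `max C₊ C₋`): the skeleton's composition
  `IndexSzpiro_of`, whose registered file is no longer on disk, restated against the route decl;
* `indexSzpiroReal_of_szpiro`, `indexSzpiroComplex_of_szpiro` — Szpiro's conjecture (the tree's
  open statement `Literature.NumberTheory.EllipticCurves.SzpiroConjecture`, used as a HYPOTHESIS)
  gives each stub, because `|d_K| ≥ 1` (hence the crux, via `indexSzpiro_of_signHalves`; the by-name
  form `SzpiroConjecture → IndexSzpiro` is deliberately not a declaration of this file, see R0b);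
  with the tree's `szpiro_of_abc` (`Summits/ABC/Harvest/OpenQuestionsGlue.lean`) the stub sits
  below abc;
* `indexSzpiroReal_iff_totallyReal` — on the cubic class the sign hypothesis `0 < d_K` is the same
  as `IsTotallyReal K` (Brill: `sign d_K = (-1)^{r₂}`, tree lemma
  `Literature.NumberTheory.CubicFields.isTotallyReal_iff_discr_pos_of_finrank_eq_three`), the form
  every totally-real engine consumes.

These are CALIBRATIONS of the stub (STUB-PLAN `Cruxes/IndexSzpiro/STUB-PLAN-stub_realCubic.md`):
`SzpiroConjecture → stub_realCubic`, `IndexSzpiro ↔ stub_realCubic ∧ stub_complexCubic`. Nothing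
here proves the stub, which is Szpiro `6+ε` on the totally-real `r = 0` class (open problem).
Elementary; standard axioms. Sources: Silverman AEC (2009) VIII.11 (Szpiro), Cohen GTM 138
Prop. 4.8.11 / Brill (sign of the discriminant).
-/

-- `Summit.<Summit>.<Problem>` is the mandated summit-side namespace (CONVENTIONS §2); for the
-- single-conjunct summit `ABC` the two coincide, so the duplicate `ABC.ABC` is deliberate.
set_option linter.dupNamespace false

namespace Summit.ABC.ABC.Theorems

open Polynomial
open Summit.ABC.ABC.Theses.CubicResolventAllowance
open Literature.NumberTheory.EllipticCurves Literature.NumberTheory.CubicFields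

/-! ### The crux gives each sign half -/

/-- R0a. The route crux `IndexSzpiro` gives the registered stub `stub_realCubic` (statement verbatim
after the colon): drop the sign hypothesis. [folklore] -/
theorem indexSzpiroReal_of_indexSzpiro (h : IndexSzpiro) :
    ∀ ε : ℝ, 0 < ε → ∃ C : ℝ, ∀ (W : WeierstrassCurve ℚ) [W.IsElliptic] (K : Type) [Field K]
      [NumberField K], Irreducible W.twoTorsionPolynomial.toPoly → Module.finrank ℚ K = 3 →
      (∃ θ : K, aeval θ W.twoTorsionPolynomial.toPoly = 0) → 0 < NumberField.discr K →
      (W.minimalDiscriminantNorm ℤ : ℝ) ≤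
        C * |(NumberField.discr K : ℝ)| * (W.conductorNorm ℤ : ℝ) ^ (6 + ε) := by
  intro ε hε
  obtain ⟨C, hC⟩ := h ε hε
  exact ⟨C, fun W _ K _ _ hirr h3 hθ _ => hC W K hirr h3 hθ⟩

/-- R0a, complex twin. The route crux `IndexSzpiro` gives the registered stub `stub_complexCubic`
(statement verbatim after the colon). [folklore] -/
theorem indexSzpiroComplex_of_indexSzpiro (h : IndexSzpiro) :
    ∀ ε : ℝ, 0 < ε → ∃ C : ℝ, ∀ (W : WeierstrassCurve ℚ) [W.IsElliptic] (K : Type) [Field K]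
      [NumberField K], Irreducible W.twoTorsionPolynomial.toPoly → Module.finrank ℚ K = 3 →
      (∃ θ : K, aeval θ W.twoTorsionPolynomial.toPoly = 0) → NumberField.discr K < 0 →
      (W.minimalDiscriminantNorm ℤ : ℝ) ≤
        C * |(NumberField.discr K : ℝ)| * (W.conductorNorm ℤ : ℝ) ^ (6 + ε) := by
  intro ε hε
  obtain ⟨C, hC⟩ := h ε hε
  exact ⟨C, fun W _ K _ _ hirr h3 hθ _ => hC W K hirr h3 hθ⟩

/-! ### The two sign halves compose back to the crux (the skeleton's `IndexSzpiro_of`) -/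

/-- The skeleton composition against the route decl: `stub_realCubic → stub_complexCubic →
IndexSzpiro` (`d_K ≠ 0`, so one of the two halves applies; constant `max C₊ C₋`). [folklore] -/
theorem indexSzpiro_of_signHalves
    (hpos : ∀ ε : ℝ, 0 < ε → ∃ C : ℝ, ∀ (W : WeierstrassCurve ℚ) [W.IsElliptic] (K : Type) [Field K]
      [NumberField K], Irreducible W.twoTorsionPolynomial.toPoly → Module.finrank ℚ K = 3 →
      (∃ θ : K, aeval θ W.twoTorsionPolynomial.toPoly = 0) → 0 < NumberField.discr K →
      (W.minimalDiscriminantNorm ℤ : ℝ) ≤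
        C * |(NumberField.discr K : ℝ)| * (W.conductorNorm ℤ : ℝ) ^ (6 + ε))
    (hneg : ∀ ε : ℝ, 0 < ε → ∃ C : ℝ, ∀ (W : WeierstrassCurve ℚ) [W.IsElliptic] (K : Type) [Field K]
      [NumberField K], Irreducible W.twoTorsionPolynomial.toPoly → Module.finrank ℚ K = 3 →
      (∃ θ : K, aeval θ W.twoTorsionPolynomial.toPoly = 0) → NumberField.discr K < 0 →
      (W.minimalDiscriminantNorm ℤ : ℝ) ≤
        C * |(NumberField.discr K : ℝ)| * (W.conductorNorm ℤ : ℝ) ^ (6 + ε)) :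
    IndexSzpiro := by
  intro ε hε
  obtain ⟨C₁, hC₁⟩ := hpos ε hε
  obtain ⟨C₂, hC₂⟩ := hneg ε hε
  refine ⟨max C₁ C₂, fun W _ K _ _ hirr hK hθ => ?_⟩
  have hN : (0 : ℝ) ≤ |(NumberField.discr K : ℝ)| * (W.conductorNorm ℤ : ℝ) ^ (6 + ε) :=
    mul_nonneg (abs_nonneg _) (Real.rpow_nonneg (Nat.cast_nonneg _) _)
  rcases lt_or_gt_of_ne (NumberField.discr_ne_zero K) with hlt | hgt
  · calc (W.minimalDiscriminantNorm ℤ : ℝ)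
        ≤ C₂ * |(NumberField.discr K : ℝ)| * (W.conductorNorm ℤ : ℝ) ^ (6 + ε) :=
          hC₂ W K hirr hK hθ hlt
      _ ≤ max C₁ C₂ * |(NumberField.discr K : ℝ)| * (W.conductorNorm ℤ : ℝ) ^ (6 + ε) := by
          rw [mul_assoc, mul_assoc]; exact mul_le_mul_of_nonneg_right (le_max_right _ _) hN
  · calc (W.minimalDiscriminantNorm ℤ : ℝ)
        ≤ C₁ * |(NumberField.discr K : ℝ)| * (W.conductorNorm ℤ : ℝ) ^ (6 + ε) :=
          hC₁ W K hirr hK hθ hgt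
      _ ≤ max C₁ C₂ * |(NumberField.discr K : ℝ)| * (W.conductorNorm ℤ : ℝ) ^ (6 + ε) := by
          rw [mul_assoc, mul_assoc]; exact mul_le_mul_of_nonneg_right (le_max_left _ _) hN

/-- The crux IS the conjunction of the skeleton's two sign stubs. [folklore] -/
theorem indexSzpiro_iff_signHalves :
    IndexSzpiro ↔
      (∀ ε : ℝ, 0 < ε → ∃ C : ℝ, ∀ (W : WeierstrassCurve ℚ) [W.IsElliptic] (K : Type) [Field K]
        [NumberField K], Irreducible W.twoTorsionPolynomial.toPoly → Module.finrank ℚ K = 3 →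
        (∃ θ : K, aeval θ W.twoTorsionPolynomial.toPoly = 0) → 0 < NumberField.discr K →
        (W.minimalDiscriminantNorm ℤ : ℝ) ≤
          C * |(NumberField.discr K : ℝ)| * (W.conductorNorm ℤ : ℝ) ^ (6 + ε)) ∧
      (∀ ε : ℝ, 0 < ε → ∃ C : ℝ, ∀ (W : WeierstrassCurve ℚ) [W.IsElliptic] (K : Type) [Field K]
        [NumberField K], Irreducible W.twoTorsionPolynomial.toPoly → Module.finrank ℚ K = 3 →
        (∃ θ : K, aeval θ W.twoTorsionPolynomial.toPoly = 0) → NumberField.discr K < 0 →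
        (W.minimalDiscriminantNorm ℤ : ℝ) ≤
          C * |(NumberField.discr K : ℝ)| * (W.conductorNorm ℤ : ℝ) ^ (6 + ε)) :=
  ⟨fun h => ⟨indexSzpiroReal_of_indexSzpiro h, indexSzpiroComplex_of_indexSzpiro h⟩,
    fun h => indexSzpiro_of_signHalves h.1 h.2⟩

/-! ### Szpiro's conjecture gives each half (calibration from above) -/

/-- R0b. `SzpiroConjecture → stub_realCubic`: the allowance `|d_K| ≥ 1` only weakens Szpiro's bound
(`C ↦ max C 0`). Deliberately NOT stated as `SzpiroConjecture → IndexSzpiro` by name: a by-name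
conclusion of the route decl under a registered conjecture would be read by the gate as a conditional
closing of stmt-ABC-22740 (debt `SzpiroConjecture`), which is not the intent of a calibration; the
by-name form is `indexSzpiro_of_signHalves (indexSzpiroReal_of_szpiro h) (indexSzpiroComplex_of_szpiro h)`
at any call site. With `Summit.ABC.Harvest.szpiro_of_abc` the stub sits below abc. [folklore] -/
theorem indexSzpiroReal_of_szpiro (h : SzpiroConjecture) :
    ∀ ε : ℝ, 0 < ε → ∃ C : ℝ, ∀ (W : WeierstrassCurve ℚ) [W.IsElliptic] (K : Type) [Field K]
      [NumberField K], Irreducible W.twoTorsionPolynomial.toPoly → Module.finrank ℚ K = 3 →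
      (∃ θ : K, aeval θ W.twoTorsionPolynomial.toPoly = 0) → 0 < NumberField.discr K →
      (W.minimalDiscriminantNorm ℤ : ℝ) ≤
        C * |(NumberField.discr K : ℝ)| * (W.conductorNorm ℤ : ℝ) ^ (6 + ε) := by
  intro ε hε
  obtain ⟨C, hC⟩ := h ε hε
  refine ⟨max C 0, fun W _ K _ _ _ _ _ _ => ?_⟩
  have h1 := hC W
  have hN : (0 : ℝ) ≤ (W.conductorNorm ℤ : ℝ) ^ (6 + ε) := by positivity
  have hd : (1 : ℝ) ≤ |(NumberField.discr K : ℝ)| := by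
    exact_mod_cast Int.one_le_abs (NumberField.discr_ne_zero K)
  calc (W.minimalDiscriminantNorm ℤ : ℝ) ≤ C * (W.conductorNorm ℤ : ℝ) ^ (6 + ε) := h1
    _ ≤ max C 0 * (W.conductorNorm ℤ : ℝ) ^ (6 + ε) := by gcongr; exact le_max_left _ _
    _ = max C 0 * 1 * (W.conductorNorm ℤ : ℝ) ^ (6 + ε) := by ring
    _ ≤ max C 0 * |(NumberField.discr K : ℝ)| * (W.conductorNorm ℤ : ℝ) ^ (6 + ε) := by gcongr

/-- R0b, complex twin: `SzpiroConjecture → stub_complexCubic`. [folklore] -/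
theorem indexSzpiroComplex_of_szpiro (h : SzpiroConjecture) :
    ∀ ε : ℝ, 0 < ε → ∃ C : ℝ, ∀ (W : WeierstrassCurve ℚ) [W.IsElliptic] (K : Type) [Field K]
      [NumberField K], Irreducible W.twoTorsionPolynomial.toPoly → Module.finrank ℚ K = 3 →
      (∃ θ : K, aeval θ W.twoTorsionPolynomial.toPoly = 0) → NumberField.discr K < 0 →
      (W.minimalDiscriminantNorm ℤ : ℝ) ≤
        C * |(NumberField.discr K : ℝ)| * (W.conductorNorm ℤ : ℝ) ^ (6 + ε) := by
  intro ε hε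
  obtain ⟨C, hC⟩ := h ε hε
  refine ⟨max C 0, fun W _ K _ _ _ _ _ _ => ?_⟩
  have h1 := hC W
  have hN : (0 : ℝ) ≤ (W.conductorNorm ℤ : ℝ) ^ (6 + ε) := by positivity
  have hd : (1 : ℝ) ≤ |(NumberField.discr K : ℝ)| := by
    exact_mod_cast Int.one_le_abs (NumberField.discr_ne_zero K)
  calc (W.minimalDiscriminantNorm ℤ : ℝ) ≤ C * (W.conductorNorm ℤ : ℝ) ^ (6 + ε) := h1
    _ ≤ max C 0 * (W.conductorNorm ℤ : ℝ) ^ (6 + ε) := by gcongr; exact le_max_left _ _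
    _ = max C 0 * 1 * (W.conductorNorm ℤ : ℝ) ^ (6 + ε) := by ring
    _ ≤ max C 0 * |(NumberField.discr K : ℝ)| * (W.conductorNorm ℤ : ℝ) ^ (6 + ε) := by gcongr

/-! ### The sign door is `IsTotallyReal` on the cubic class -/

/-- D1. On cubic fields `0 < d_K ↔ IsTotallyReal K`, so `stub_realCubic` is the stub over totally real
resolvent fields (statement: the two `∀ ε …` sentences are equivalent).
[cite: Cohen1993, Prop. 4.8.11] -/
theorem indexSzpiroReal_iff_totallyReal :
    (∀ ε : ℝ, 0 < ε → ∃ C : ℝ, ∀ (W : WeierstrassCurve ℚ) [W.IsElliptic] (K : Type) [Field K]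
        [NumberField K], Irreducible W.twoTorsionPolynomial.toPoly → Module.finrank ℚ K = 3 →
        (∃ θ : K, aeval θ W.twoTorsionPolynomial.toPoly = 0) → 0 < NumberField.discr K →
        (W.minimalDiscriminantNorm ℤ : ℝ) ≤
          C * |(NumberField.discr K : ℝ)| * (W.conductorNorm ℤ : ℝ) ^ (6 + ε)) ↔
      (∀ ε : ℝ, 0 < ε → ∃ C : ℝ, ∀ (W : WeierstrassCurve ℚ) [W.IsElliptic] (K : Type) [Field K]
        [NumberField K], Irreducible W.twoTorsionPolynomial.toPoly → Module.finrank ℚ K = 3 →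
        (∃ θ : K, aeval θ W.twoTorsionPolynomial.toPoly = 0) → NumberField.IsTotallyReal K →
        (W.minimalDiscriminantNorm ℤ : ℝ) ≤
          C * |(NumberField.discr K : ℝ)| * (W.conductorNorm ℤ : ℝ) ^ (6 + ε)) := by
  constructor
  · intro h ε hε
    obtain ⟨C, hC⟩ := h ε hε
    exact ⟨C, fun W _ K _ _ hirr hK hθ hT =>
      hC W K hirr hK hθ ((isTotallyReal_iff_discr_pos_of_finrank_eq_three K hK).mp hT)⟩
  · intro h ε hε
    obtain ⟨C, hC⟩ := h ε hε
    exact ⟨C, fun W _ K _ _ hirr hK hθ hd =>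
      hC W K hirr hK hθ ((isTotallyReal_iff_discr_pos_of_finrank_eq_three K hK).mpr hd)⟩

end Summit.ABC.ABC.Theorems
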